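import Mathlib
import HarnessLib
import Literature.NumberTheory.GaloisRepresentations.OrdinaryGaloisRep
import Literature.NumberTheory.GaloisRepresentations.ArtinRestriction
import Literature.NumberTheory.GaloisRepresentations.DecompositionGroupOfCompletion
import Summits.Langlands.Langlands.Theorems.EisensteinProModularSeed.Negative.BorelAndEisenstein

/-!
# Stub `stub_restrictTwistGaloisPackage` (line `descend-raise-basechange`, crux stmt-Langlands-12920) —
# auxiliary file II: decomposition groups under `Γ_E → Γ_K`, and Clifford theory in index two

Helper lemmas (all proved, no new definition) for the Galois-side transport S3 of the line
`descend-raise-basechange` of `Summit.Langlands.Langlands.Theses.SkinnerWilesDefectOne.EisensteinProModularSeed`: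

* **primes, decomposition and inertia groups under `res : Γ_E → Γ_K`** for number fields `K ⊆ E`
  (`exists_primesAbove_restrict_decomp`, a variant of the tree's `exists_primesAbove_restrict` that also
  records `res(D_𝔔) ≤ D_𝔓`), and its consequence for the completions
  (`exists_conj_absGaloisRestrict_adicCompletion`): for `w ∣ v` the composite
  `Γ_{E_w} → Γ_E → Γ_K` lands in a conjugate `τ · res(Γ_{K_v}) · τ⁻¹` of the image of `Γ_{K_v}`, and maps
  the inertia group `I_{E_w}` into `τ · res(I_{K_v}) · τ⁻¹` (Neukirch, *Algebraic Number Theory*, Ch. II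
  §9, Prop. (9.6), through the tree's `decompositionSubgroup_adicCompletionPrime_eq_range` /
  `inertia_adicCompletionPrime_eq_map_absInertia` and the transitivity of `Γ_K` on the primes above `v`);
* places: the place of `ℚ` below a place of `F` (`exists_heightOneSpectrum_under`) and a place above
  `p` (`exists_heightOneSpectrum_mem_natCast`);
* **Clifford theory for an index-two subgroup in rank two** (`exists_stableLine_of_not_isIrreducible`,
  `trace_eq_zero_of_not_isIrreducible`): if `ρ : G → GL₂(A)` is irreducible over a field `A`, `H ≤ G`
  has index `2` and a scalar twist of `ρ|_H` is reducible, then `tr ρ(τ) = 0` for all `τ ∉ H`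
  (`ρ ≅ Ind_H^G ψ`; Curtis–Reiner, *Methods of Representation Theory* I, §11).

References: J. Neukirch, *Algebraic Number Theory* (1999), Ch. I §9, Ch. II §9; C. W. Curtis,
I. Reiner, *Methods of Representation Theory* I (1981), §11 (Clifford's theorem). [folklore]
-/

set_option linter.dupNamespace false -- project-wide option (lakefile weak.linter.dupNamespace); `Summit.Langlands.Langlands` is the mandated namespace

noncomputable section

namespace Summit.Langlands.Langlands.Theorems.SkinnerWilesDefectOne.EisensteinProModularSeed.RestrictTwist

open Literature.NumberTheory.GaloisRepresentations
open Summit.Langlands.Langlands.Theorems.EisensteinProModularSeed.Negative (not_isIrreducible_of_stableLine)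
open Field IsDedekindDomain NumberField
open scoped NumberField Matrix Pointwise

/-! ### Places -/

section Places

variable (K : Type*) {F : Type*} [Field K] [Field F] [Algebra K F]

/-- The place of `K` below a finite place `v` of the extension `F ⊇ K` of number fields (`v ∩ 𝓞 K`,
non-zero since `𝓞 F / 𝓞 K` is integral). [folklore] -/
theorem exists_heightOneSpectrum_under (v : HeightOneSpectrum (𝓞 F)) :
    ∃ w : HeightOneSpectrum (𝓞 K), v.asIdeal.under (𝓞 K) = w.asIdeal :=
  ⟨⟨v.asIdeal.under (𝓞 K), inferInstance, fun h => v.ne_bot (Ideal.eq_bot_of_comap_eq_bot h)⟩, rfl⟩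

/-- Membership of a rational integer in the place below. [folklore] -/
theorem natCast_mem_under_iff (v : HeightOneSpectrum (𝓞 F)) (m : ℕ) :
    (m : 𝓞 K) ∈ v.asIdeal.under (𝓞 K) ↔ (m : 𝓞 F) ∈ v.asIdeal := by
  rw [Ideal.under, Ideal.mem_comap, map_natCast]

variable [NumberField F]

/-- Every rational prime `p` lies below some finite place of the number field `F`. [folklore] -/
theorem exists_heightOneSpectrum_mem_natCast (p : ℕ) [Fact p.Prime] :
    ∃ v : HeightOneSpectrum (𝓞 F), (p : 𝓞 F) ∈ v.asIdeal := by
  haveI hP : (Ideal.span {(p : ℤ)}).IsMaximal :=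
    PrincipalIdealRing.isMaximal_of_irreducible
      (Nat.prime_iff_prime_int.mp Fact.out).irreducible
  obtain ⟨Q, hQmax, hQover⟩ :=
    Ideal.exists_maximal_ideal_liesOver_of_isIntegral (S := 𝓞 F) (Ideal.span {(p : ℤ)})
  have hpQ : (p : 𝓞 F) ∈ Q := by
    have h : algebraMap ℤ (𝓞 F) p ∈ Q := by
      rw [← Ideal.mem_comap]
      change (p : ℤ) ∈ Q.under ℤ
      rw [← hQover.over]
      exact Ideal.mem_span_singleton_self _
    simpa using h
  refine ⟨⟨Q, hQmax.isPrime, fun h => ?_⟩, hpQ⟩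
  rw [h] at hpQ
  exact (Nat.cast_ne_zero.mpr (Fact.out : p.Prime).ne_zero) ((Submodule.mem_bot _).mp hpQ)

end Places

/-! ### Decomposition and inertia groups under `Γ_E → Γ_K` -/

section Transfer

variable (K E : Type*) [Field K] [Field E] [Algebra K E]

/-- If `σ ∈ I_{τ • 𝔓}` then `τ⁻¹ σ τ ∈ I_𝔓`. [folklore] -/
theorem mem_inertia_of_mem_inertia_smul [NumberField K] {𝔓 : Ideal (absIntegers (𝓞 K) K)}
    {τ σ : absoluteGaloisGroup K} (hσ : σ ∈ (τ • 𝔓).inertia (absoluteGaloisGroup K)) :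
    τ⁻¹ * σ * τ ∈ 𝔓.inertia (absoluteGaloisGroup K) := by
  -- adapted from `GaloisRep.IsUnramifiedAtPrime.smul`
  intro x
  have hx : σ • τ • x - τ • x ∈ τ • 𝔓 := hσ (τ • x)
  rw [Ideal.mem_pointwise_smul_iff_inv_smul_mem, smul_sub] at hx
  simpa [mul_smul] using hx

/-- If `σ ∈ D_{τ • 𝔓}` then `τ⁻¹ σ τ ∈ D_𝔓`. [folklore] -/
theorem mem_decompositionSubgroup_of_smul [NumberField K] {𝔓 : Ideal (absIntegers (𝓞 K) K)}
    {τ σ : absoluteGaloisGroup K}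
    (hσ : σ ∈ (τ • 𝔓).decompositionSubgroup (absoluteGaloisGroup K)) :
    τ⁻¹ * σ * τ ∈ 𝔓.decompositionSubgroup (absoluteGaloisGroup K) := by
  change σ ∈ MulAction.stabilizer (absoluteGaloisGroup K) (τ • 𝔓) at hσ
  rw [MulAction.stabilizer_smul_eq_stabilizer_map_conj] at hσ
  obtain ⟨h, hh, rfl⟩ := Subgroup.mem_map.mp hσ
  have e : τ⁻¹ * (MulAut.conj τ).toMonoidHom h * τ = h := by
    rw [MulEquiv.coe_toMonoidHom, MulAut.conj_apply]; group
  rw [e]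
  exact hh

/-- **Primes, decomposition and inertia under `Γ_E → Γ_K`.** For `w ∣ v` and a prime `𝔔` of `\bar ℤ_E`
above `w`, the prime `𝔓 = ι⁻¹(𝔔)` of `\bar ℤ_K` lies above `v`, and the restriction `res : Γ_E → Γ_K`
maps `D_𝔔` into `D_𝔓` and `I_𝔔` into `I_𝔓` (variant of the tree's `exists_primesAbove_restrict`,
which records inertia and Frobenius). Neukirch, *Algebraic Number Theory*, Ch. I §9. [folklore] -/
theorem exists_primesAbove_restrict_decomp [NumberField K] [NumberField E]
    {v : HeightOneSpectrum (𝓞 K)} {w : HeightOneSpectrum (𝓞 E)}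
    (hw : w.asIdeal.under (𝓞 K) = v.asIdeal) {𝔔 : Ideal (absIntegers (𝓞 E) E)}
    (h𝔔 : 𝔔 ∈ w.primesAbove) :
    ∃ 𝔓 ∈ v.primesAbove,
      (∀ γ : absoluteGaloisGroup E, γ • 𝔔 = 𝔔 → absGaloisRestrict K E γ • 𝔓 = 𝔓) ∧
      (∀ γ ∈ 𝔔.inertia (absoluteGaloisGroup E),
        absGaloisRestrict K E γ ∈ 𝔓.inertia (absoluteGaloisGroup K)) := by
  -- adapted from `Literature.NumberTheory.GaloisRepresentations.exists_primesAbove_restrict`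
  classical
  let ιo : absIntegers (𝓞 K) K →+* absIntegers (𝓞 E) E :=
    ((absClosureEmbedding K E).toRingHom.comp (absIntegers (𝓞 K) K).val.toRingHom).codRestrict
      (absIntegers (𝓞 E) E) (fun x => absClosureEmbedding_mem_absIntegers K E x)
  have hιo_smul : ∀ (γ : absoluteGaloisGroup E) (x : absIntegers (𝓞 K) K),
      ιo (absGaloisRestrict K E γ • x) = γ • ιo x := fun γ x => by
    apply Subtype.ext
    change absClosureEmbedding K E (absGaloisRestrict K E γ • (x : AlgebraicClosure K)) =
      γ • absClosureEmbedding K E x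
    exact absGaloisRestrict_apply_smul K E γ x
  have hιo_alg : ιo.comp (algebraMap (𝓞 K) (absIntegers (𝓞 K) K)) =
      (algebraMap (𝓞 E) (absIntegers (𝓞 E) E)).comp (algebraMap (𝓞 K) (𝓞 E)) := by
    ext r
    change absClosureEmbedding K E (algebraMap (𝓞 K) (AlgebraicClosure K) r) =
      algebraMap (𝓞 E) (AlgebraicClosure E) (algebraMap (𝓞 K) (𝓞 E) r)
    rw [IsScalarTower.algebraMap_apply (𝓞 K) K (AlgebraicClosure K), AlgHom.commutes,
      IsScalarTower.algebraMap_apply (𝓞 E) E (AlgebraicClosure E),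
      ← IsScalarTower.algebraMap_apply (𝓞 K) (𝓞 E) E, IsScalarTower.algebraMap_apply (𝓞 K) K E,
      ← IsScalarTower.algebraMap_apply K E (AlgebraicClosure E)]
  set 𝔓 : Ideal (absIntegers (𝓞 K) K) := 𝔔.comap ιo with h𝔓def
  haveI : 𝔔.IsPrime := h𝔔.1
  haveI : 𝔔.LiesOver w.asIdeal := h𝔔.2
  have h𝔓prime : 𝔓.IsPrime := Ideal.comap_isPrime ιo 𝔔
  have h𝔓over : 𝔓.LiesOver v.asIdeal := by
    constructor
    rw [← hw]
    change _ = Ideal.comap (algebraMap (𝓞 K) (absIntegers (𝓞 K) K)) (Ideal.comap ιo 𝔔)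
    rw [Ideal.comap_comap, hιo_alg, ← Ideal.comap_comap]
    change Ideal.comap (algebraMap (𝓞 K) (𝓞 E)) (w.asIdeal) =
      Ideal.comap (algebraMap (𝓞 K) (𝓞 E)) (𝔔.under (𝓞 E))
    rw [← Ideal.LiesOver.over (P := 𝔔) (p := w.asIdeal)]
  refine ⟨𝔓, ⟨h𝔓prime, h𝔓over⟩, fun γ hγ => ?_, fun γ hγ x => ?_⟩
  · ext x
    rw [Ideal.mem_pointwise_smul_iff_inv_smul_mem, h𝔓def, Ideal.mem_comap, Ideal.mem_comap,
      ← map_inv, hιo_smul, ← Ideal.mem_pointwise_smul_iff_inv_smul_mem, hγ]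
  · change absGaloisRestrict K E γ • x - x ∈ Ideal.comap ιo 𝔔
    rw [Ideal.mem_comap, map_sub, hιo_smul]
    exact hγ (ιo x)

/-- **The local Galois groups of `K_v` and `E_w`, `w ∣ v`, inside `Γ_K`.** There is `τ ∈ Γ_K` such
that the composite `Γ_{E_w} → Γ_E → Γ_K` (restriction maps along the chosen embeddings of algebraic
closures) takes values in `τ · res(Γ_{K_v}) · τ⁻¹` and maps the inertia group `I_{E_w}` into
`τ · res(I_{K_v}) · τ⁻¹`: the image of `Γ_{E_w}` lies in the decomposition group of the prime
`ι⁻¹(𝔓₀(E, w))` above `v`, which is a `Γ_K`-conjugate of the prime `𝔓₀(K, v)` whose decomposition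
(resp. inertia) group is `res(Γ_{K_v})` (resp. `res(I_{K_v})`). Neukirch, *Algebraic Number Theory*,
Ch. II §9, Prop. (9.6). [folklore] -/
theorem exists_conj_absGaloisRestrict_adicCompletion [NumberField K] [NumberField E]
    {v : HeightOneSpectrum (𝓞 K)} {w : HeightOneSpectrum (𝓞 E)}
    (hw : w.asIdeal.under (𝓞 K) = v.asIdeal) :
    ∃ τ : absoluteGaloisGroup K,
      (∀ σ : absoluteGaloisGroup (w.adicCompletion E),
        ∃ σ' : absoluteGaloisGroup (v.adicCompletion K),
          absGaloisRestrict K E (absGaloisRestrict E (w.adicCompletion E) σ) =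
            τ * absGaloisRestrict K (v.adicCompletion K) σ' * τ⁻¹) ∧
      (∀ σ ∈ absInertia (w.adicCompletion E),
        ∃ σ' ∈ absInertia (v.adicCompletion K),
          absGaloisRestrict K E (absGaloisRestrict E (w.adicCompletion E) σ) =
            τ * absGaloisRestrict K (v.adicCompletion K) σ' * τ⁻¹) := by
  obtain ⟨𝔓, h𝔓, hD, hI⟩ :=
    exists_primesAbove_restrict_decomp K E hw (adicCompletionPrime_mem_primesAbove E w)
  obtain ⟨τ, hτ⟩ := HeightOneSpectrum.exists_smul_eq_of_mem_primesAbove_holds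
    (adicCompletionPrime_mem_primesAbove K v) h𝔓
  refine ⟨τ, fun σ => ?_, fun σ hσ => ?_⟩
  · have h1 : absGaloisRestrict E (w.adicCompletion E) σ • adicCompletionPrime E w =
        adicCompletionPrime E w :=
      Ideal.mem_decompositionSubgroup_iff.mp
        ((decompositionSubgroup_adicCompletionPrime_eq_range E w).symm ▸ ⟨σ, rfl⟩)
    have h2 := hD _ h1
    rw [← hτ] at h2
    have h3 := mem_decompositionSubgroup_of_smul K (Ideal.mem_decompositionSubgroup_iff.mpr h2)
    rw [decompositionSubgroup_adicCompletionPrime_eq_range] at h3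
    obtain ⟨σ', hσ'⟩ := h3
    have hσ'' : absGaloisRestrict K (v.adicCompletion K) σ' = _ := hσ'
    refine ⟨σ', ?_⟩
    rw [hσ'']
    group
  · have h1 : absGaloisRestrict E (w.adicCompletion E) σ ∈
        (adicCompletionPrime E w).inertia (absoluteGaloisGroup E) := by
      rw [inertia_adicCompletionPrime_eq_map_absInertia]
      exact ⟨σ, hσ, rfl⟩
    have h2 := hI _ h1
    rw [← hτ] at h2
    have h3 := mem_inertia_of_mem_inertia_smul K h2
    rw [inertia_adicCompletionPrime_eq_map_absInertia] at h3
    obtain ⟨σ', hσ', h⟩ := h3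
    have h' : absGaloisRestrict K (v.adicCompletion K) σ' = _ := h
    refine ⟨σ', hσ', ?_⟩
    rw [h']
    group

end Transfer

/-! ### Clifford theory: index two, rank two -/

section Clifford

variable {G G' : Type*} [Group G] [TopologicalSpace G] [Group G'] [TopologicalSpace G']
  {A : Type*} [Field A] [TopologicalSpace A]

/-- A REDUCIBLE rank-two framed representation over a field has a stable line: a proper non-zero
subrepresentation `W` is a line `⟨w⟩` (if `r(g) w ∉ ⟨w⟩` then `w, r(g) w` span everything).
[folklore] -/
theorem exists_stableLine_of_not_isIrreducible (r : FramedRep G A 2) (h : ¬ r.IsIrreducible) :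
    ∃ w : Fin 2 → A, w ≠ 0 ∧ ∀ g, (r g).val *ᵥ w ∈ Submodule.span A {w} := by
  have hW : ∃ W : Subrepresentation r.toRepresentation, W ≠ ⊥ ∧ W ≠ ⊤ := by
    by_contra hall
    push Not at hall
    apply h
    have hbt : (⊥ : Subrepresentation r.toRepresentation) ≠ ⊤ := by
      intro hbt
      have h1 : (Pi.single 0 1 : Fin 2 → A) ∈ (⊤ : Subrepresentation r.toRepresentation) := by
        change (Pi.single 0 1 : Fin 2 → A) ∈ (⊤ : Submodule A (Fin 2 → A))
        exact Submodule.mem_top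
      rw [← hbt] at h1
      change (Pi.single 0 1 : Fin 2 → A) ∈ (⊥ : Submodule A (Fin 2 → A)) at h1
      rw [Submodule.mem_bot] at h1
      have h2 : (Pi.single 0 1 : Fin 2 → A) 0 = 0 := congrFun h1 0
      rw [Pi.single_eq_same] at h2
      exact one_ne_zero h2
    haveI : Nontrivial (Subrepresentation r.toRepresentation) := ⟨⊥, ⊤, hbt⟩
    exact ⟨fun W => or_iff_not_imp_left.mpr (hall W)⟩
  obtain ⟨W, hWb, hWt⟩ := hW
  have hne : ∃ w ∈ W, w ≠ (0 : Fin 2 → A) := by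
    by_contra hall
    push Not at hall
    apply hWb
    apply le_antisymm _ bot_le
    intro w hw
    rw [hall w hw]
    change (0 : Fin 2 → A) ∈ (⊥ : Submodule A (Fin 2 → A))
    exact Submodule.zero_mem _
  obtain ⟨w, hwW, hw0⟩ := hne
  refine ⟨w, hw0, fun g => ?_⟩
  by_contra hnot
  apply hWt
  have hli : LinearIndependent A ![w, (r g).val *ᵥ w] := by
    rw [LinearIndependent.pair_iff' hw0]
    intro a ha
    apply hnot
    rw [← ha]
    exact Submodule.smul_mem _ a (Submodule.mem_span_singleton_self w)
  have hspan : Submodule.span A (Set.range ![w, (r g).val *ᵥ w]) = ⊤ :=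
    hli.span_eq_top_of_card_eq_finrank' (by simp)
  have hle : Submodule.span A (Set.range ![w, (r g).val *ᵥ w]) ≤ W.toSubmodule := by
    rw [Submodule.span_le]
    rintro _ ⟨i, rfl⟩
    fin_cases i
    · exact hwW
    · exact W.apply_mem_toSubmodule g hwW
  rw [hspan, top_le_iff] at hle
  apply le_antisymm le_top
  intro x _
  change x ∈ W.toSubmodule
  rw [hle]
  exact Submodule.mem_top

/-- **Clifford theory, index two, rank two.** Let `ρ : G → GL₂(A)` be irreducible over the field `A`,
`H ≤ G` a subgroup of index `2`, and `r : G' → GL₂(A)` a representation which is, up to non-zero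
scalars, the pull-back of `ρ` along a map `φ : G' → G` with image `H`. If `r` is reducible then
`tr ρ(τ) = 0` for every `τ ∉ H`: an `H`-stable line `L` for `ρ` has `ρ(τ)L` again `H`-stable (`H` is
normal); `ρ(τ)L = L` would make `L` `G`-stable, so `V = L ⊕ ρ(τ)L` with `ρ(τ)` swapping the two lines
(`τ² ∈ H`), i.e. `ρ ≅ Ind_H^G ψ` and `ρ(τ)` has zero diagonal. Curtis–Reiner, *Methods of
Representation Theory* I (1981), §11. [folklore] -/
theorem trace_eq_zero_of_not_isIrreducible (ρ : FramedRep G A 2) (r : FramedRep G' A 2)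
    (φ : G' → G) (H : Subgroup G) (hH : H.index = 2) (hφ : ∀ g, g ∈ H ↔ g ∈ Set.range φ)
    (hr : ∀ σ, ∃ c : A, c ≠ 0 ∧ (r σ).val = c • (ρ (φ σ)).val)
    (hirr : ρ.IsIrreducible) (hred : ¬ r.IsIrreducible) :
    ∀ τ, τ ∉ H → (ρ τ).val.trace = 0 := by
  obtain ⟨w, hw0, hst⟩ := exists_stableLine_of_not_isIrreducible r hred
  have hH' : ∀ h ∈ H, (ρ h).val *ᵥ w ∈ Submodule.span A {w} := by
    intro h hh
    obtain ⟨σ, rfl⟩ := (hφ h).mp hh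
    obtain ⟨c, hc, hcσ⟩ := hr σ
    have h1 := hst σ
    rw [hcσ, Matrix.smul_mulVec] at h1
    have h2 := Submodule.smul_mem _ c⁻¹ h1
    rwa [smul_smul, inv_mul_cancel₀ hc, one_smul] at h2
  intro τ hτ
  set w' := (ρ τ).val *ᵥ w with hw'
  by_cases hcase : w' ∈ Submodule.span A {w}
  · exfalso
    refine not_isIrreducible_of_stableLine ρ w hw0 (fun g => ?_) hirr
    suffices hmem : (ρ g).val *ᵥ w ∈ Submodule.span A {w} by
      obtain ⟨a, ha⟩ := Submodule.mem_span_singleton.mp hmem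
      exact ⟨a, ha.symm⟩
    by_cases hg : g ∈ H
    · exact hH' g hg
    · have hg' : τ⁻¹ * g ∈ H := by
        rw [Subgroup.mul_mem_iff_of_index_two hH, Subgroup.inv_mem_iff]
        exact iff_of_false hτ hg
      have e : (ρ g).val *ᵥ w = (ρ τ).val *ᵥ ((ρ (τ⁻¹ * g)).val *ᵥ w) := by
        rw [Matrix.mulVec_mulVec, ← Units.val_mul, ← map_mul, mul_inv_cancel_left]
      rw [e]
      obtain ⟨a, ha⟩ := Submodule.mem_span_singleton.mp (hH' _ hg')
      rw [← ha, Matrix.mulVec_smul]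
      exact Submodule.smul_mem _ a hcase
  · have hτ2 : τ * τ ∈ H := by
      rw [Subgroup.mul_mem_iff_of_index_two hH]
    have hli : LinearIndependent A ![w, w'] := by
      rw [LinearIndependent.pair_iff' hw0]
      intro a ha
      apply hcase
      rw [← ha]
      exact Submodule.smul_mem _ a (Submodule.mem_span_singleton_self w)
    have hsp : ⊤ ≤ Submodule.span A (Set.range ![w, w']) :=
      (hli.span_eq_top_of_card_eq_finrank' (by simp)).ge
    let b := Module.Basis.mk hli hsp
    have hb0 : b 0 = w := by simp [b]
    have hb1 : b 1 = w' := by simp [b]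
    have hf1 : (ρ τ).val *ᵥ w' ∈ Submodule.span A {w} := by
      rw [hw', Matrix.mulVec_mulVec, ← Units.val_mul, ← map_mul]
      exact hH' _ hτ2
    obtain ⟨c, hc⟩ := Submodule.mem_span_singleton.mp hf1
    have e0 : (ρ τ).val *ᵥ b 0 = b 1 := by rw [hb0, hb1]
    have e1 : (ρ τ).val *ᵥ b 1 = c • b 0 := by rw [hb1, hb0, hc]
    have htr : (ρ τ).val.trace = LinearMap.trace A _ (Matrix.toLin' (ρ τ).val) := by
      rw [LinearMap.trace_eq_matrix_trace A (Pi.basisFun A (Fin 2)), LinearMap.toMatrix_eq_toMatrix',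
        LinearMap.toMatrix'_toLin']
    rw [htr, LinearMap.trace_eq_matrix_trace A b, Matrix.trace_fin_two, LinearMap.toMatrix_apply,
      LinearMap.toMatrix_apply, Matrix.toLin'_apply, Matrix.toLin'_apply, e0, e1, map_smul,
      b.repr_self, b.repr_self, Finsupp.smul_apply, Finsupp.single_eq_of_ne (by decide),
      Finsupp.single_eq_of_ne (by decide), smul_zero, add_zero]

end Clifford

end Summit.Langlands.Langlands.Theorems.SkinnerWilesDefectOne.EisensteinProModularSeed.RestrictTwist

namespace Summit.Langlands.Langlands.Theorems.SkinnerWilesDefectOne.EisensteinProModularSeed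

/-- **Registered sub-goal of `stub_restrictTwistGaloisPackage` (auxiliary file II): the local Galois groups
of `K_v` and `E_w`, `w ∣ v`, inside `Γ_K`** (= `RestrictTwist.exists_conj_absGaloisRestrict_adicCompletion`
for number fields in `Type`, explicit binders, fully qualified). Neukirch, *Algebraic Number Theory*,
Ch. II §9, Prop. (9.6). [folklore] -/
theorem stub_restrictTwistGaloisPackage_auxTransfer :
    ∀ (K E : Type) [Field K] [NumberField K] [Field E] [NumberField E] [Algebra K E] (v : IsDedekindDomain.HeightOneSpectrum (NumberField.RingOfIntegers K)) (w : IsDedekindDomain.HeightOneSpectrum (NumberField.RingOfIntegers E)), w.asIdeal.under (NumberField.RingOfIntegers K) = v.asIdeal → ∃ τ : Field.absoluteGaloisGroup K, (∀ σ : Field.absoluteGaloisGroup (w.adicCompletion E), ∃ σ' : Field.absoluteGaloisGroup (v.adicCompletion K), Literature.NumberTheory.GaloisRepresentations.absGaloisRestrict K E (Literature.NumberTheory.GaloisRepresentations.absGaloisRestrict E (w.adicCompletion E) σ) = τ * Literature.NumberTheory.GaloisRepresentations.absGaloisRestrict K (v.adicCompletion K) σ' * τ⁻¹) ∧ (∀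 σ ∈ Literature.NumberTheory.GaloisRepresentations.absInertia (w.adicCompletion E), ∃ σ' ∈ Literature.NumberTheory.GaloisRepresentations.absInertia (v.adicCompletion K), Literature.NumberTheory.GaloisRepresentations.absGaloisRestrict K E (Literature.NumberTheory.GaloisRepresentations.absGaloisRestrict E (w.adicCompletion E) σ) = τ * Literature.NumberTheory.GaloisRepresentations.absGaloisRestrict K (v.adicCompletion K) σ' * τ⁻¹) :=
  fun K E _ _ _ _ _ _ _ hw => RestrictTwist.exists_conj_absGaloisRestrict_adicCompletion K E hw

end Summit.Langlands.Langlands.Theorems.SkinnerWilesDefectOne.EisensteinProModularSeed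

end
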